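import Literature.NumberTheory.Rogawski1990.ArchEllipticOrbitVolumeGrowth                -- ★ p848765 (LH3-p03): `haar_setOf_hs_conj_le_of_elliptic_linear` (group side, per place)
import Literature.NumberTheory.Rogawski1990.ArchSchwartzOrbitalIntegralConvergenceElliptic -- ★ p848849 (§3): `isCompact_centralizer_archLocal_of_conj_torusMatrix`
import Literature.MeasureTheory.Group.InvariantQuotientCompactSubgroup                    -- ★ `quotientMeasure_eq_inv_smul_map_mk`
import HarnessLib

/-!
# The per-place quotient-growth token `hplace` at an ELLIPTIC place: `μ_w{x̄ ∣ Σ|(x̄ γ_w x̄⁻¹)_{ij}|² + 1 ≤ ρ} ≤ C ρ^{1∕2}` for the Weil-form quotient `μ_w = dν_w ∕ dρ_w`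
# (DEAL #20 of line LH3: LH3-p03's group-side bound descended through the compact centraliser)

Topic `NumberTheory/Rogawski1990`; namespace `Literature.NumberTheory.Rogawski1990`.  THEOREMS ONLY (no `def`, no instance, no notation, no axiom, no named fact,
no `sorry`).  Cell `pub/hodgecm-mathlib`, crux H413 (`stmt-HodgeConjecture-24833`), F0∕P3c line LH3, DEAL #20 of LH3-plan (g0) (2026-09-02T04:15:58Z; seat LH3-p04 (g0)): the
ELLIPTIC discharger of the per-place hypothesis `hplace` of ★ `integrable_orbitalIntegrand_of_archSchwartzGL_of_placewise_growth'` (p849061), in EXACTLY that binder text, for the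
invariant quotient measure `quotientMeasure Z(γ_w) ρ_w ν_w` at a place `w` where `γ_w` is a `U(Φ₂)(ℂ)_w`-conjugate of a regular compact-torus point `torusMatrix l₁ l₂` (`l₁ ≠ l₂`):
`Z(γ_w)` is compact (★ `isCompact_centralizer_archLocal_of_conj_torusMatrix`), so `μ_w = ρ_w(Z)⁻¹ • π_* ν_w` (★ `quotientMeasure_eq_inv_smul_map_mk`) and LH3-p03's ★ group-side
bound `ν_w{y ∣ Σ|(y γ_w y⁻¹)_{ij}|² + 1 ≤ ρ} ≤ C ρ^{1∕2}` (★ `haar_setOf_hs_conj_le_of_elliptic_linear`, p848765) descends with constant `C ∕ ρ_w(Z)`.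
HONEST LABEL: HC_CM is proved only modulo the 7 printed citations (2 remaining: hLiu418 = stmt-HodgeConjecture-24832, h413 = stmt-HodgeConjecture-24833) until rung 0
closes; this file closes no organ — with it, (CONV) at a `G`-regular class whose places are all elliptic or split rests only on LH2-p04's split-place token and the regular
dichotomy (LH3-p01's DEAL #21).

## References
* [BeuzartPlessis2020Asterisque] R. Beuzart-Plessis, *A local trace formula for the Gan–Gross–Prasad conjecture for unitary groups: the archimedean case*,
  Astérisque 418 (2020), §1.5 (1.5.2)–(1.5.3) p. 31.
* [Folland1995] G. B. Folland, *A Course in Abstract Harmonic Analysis* (1995), §2.6 (2.52).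
* [Rogawski1990] J. D. Rogawski, *Automorphic Representations of Unitary Groups in Three Variables*, Ann. of Math. Stud. 123 (1990), §3.1 p. 19; §4.3 (4.3.1) p. 43.
-/

set_option autoImplicit false

noncomputable section

open MeasureTheory Set NumberField
open Literature.MeasureTheory.Group Literature.NumberTheory.Automorphic Literature.NumberTheory.Automorphic.UnitaryGroup
open scoped ENNReal MatrixGroups Matrix

namespace Literature.NumberTheory.Rogawski1990

section EllipticPlace

variable (L : Type) [Field L] (w : {w : InfinitePlace L // w.IsComplex})
    [MeasurableSpace ↥(archLocal L 2 (Matrix.of fun i j : Fin 2 => if i.val + j.val + 1 = 2 then (1 : L) else 0) w)]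
    [BorelSpace ↥(archLocal L 2 (Matrix.of fun i j : Fin 2 => if i.val + j.val + 1 = 2 then (1 : L) else 0) w)]

/-- **`hplace` AT AN ELLIPTIC PLACE.**  `γ = g₀ · torusMatrix l₁ l₂ · g₀⁻¹` with `l₁ ≠ l₂` in `U(Φ₂)(ℂ)_w`; `ν` a Haar measure on `U(Φ₂)(ℂ)_w`, `ρ` a Haar, inversion-invariant measure on the
(compact) centraliser `Z(γ)`.  Then the Weil-form quotient measure satisfies `(dν∕dρ){x̄ ∣ Σ|(x̄ γ x̄⁻¹)_{ij}|² + 1 ≤ r} ≤ C r^{1∕2}` for `r ≥ 1` — LH3-p03's group-side bound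
(★ `haar_setOf_hs_conj_le_of_elliptic_linear`) divided by `ρ(Z)` (★ `quotientMeasure_eq_inv_smul_map_mk`; `Z(γ)` compact by ★ `isCompact_centralizer_archLocal_of_conj_torusMatrix`).  The instance hypotheses
`[LocallyCompactSpace] [SecondCountableTopology]` on `U(Φ₂)(ℂ)_w` are ★ `locallyCompactSpace∕secondCountableTopology_unitaryGroupOfForm_complex` at the call site.
[cite: BeuzartPlessis2020Asterisque, §1.5 (1.5.2)–(1.5.3) p. 31] [cite: Folland1995, §2.6 (2.52)] [cite: Rogawski1990, §4.3 (4.3.1) p. 43] -/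
theorem quotientMeasure_hsOrbitBall_le_sqrt_of_elliptic
    [LocallyCompactSpace ↥(archLocal L 2 (Matrix.of fun i j : Fin 2 => if i.val + j.val + 1 = 2 then (1 : L) else 0) w)]
    [SecondCountableTopology ↥(archLocal L 2 (Matrix.of fun i j : Fin 2 => if i.val + j.val + 1 = 2 then (1 : L) else 0) w)]
    (ν : Measure ↥(archLocal L 2 (Matrix.of fun i j : Fin 2 => if i.val + j.val + 1 = 2 then (1 : L) else 0) w)) [ν.IsHaarMeasure] [ν.IsMulRightInvariant]
    (γ g₀ : ↥(archLocal L 2 (Matrix.of fun i j : Fin 2 => if i.val + j.val + 1 = 2 then (1 : L) else 0) w)) {l₁ l₂ : ℂ} (hne : l₁ ≠ l₂)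
    (hγ : ((γ : GL (Fin 2) ℂ) : Matrix (Fin 2) (Fin 2) ℂ) =
      ((g₀ : GL (Fin 2) ℂ) : Matrix (Fin 2) (Fin 2) ℂ) * torusMatrix l₁ l₂ * (((g₀ : GL (Fin 2) ℂ)) : Matrix (Fin 2) (Fin 2) ℂ)⁻¹)
    [MeasurableSpace (↥(archLocal L 2 (Matrix.of fun i j : Fin 2 => if i.val + j.val + 1 = 2 then (1 : L) else 0) w) ⧸
      Subgroup.centralizer ({γ} : Set ↥(archLocal L 2 (Matrix.of fun i j : Fin 2 => if i.val + j.val + 1 = 2 then (1 : L) else 0) w)))]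
    [BorelSpace (↥(archLocal L 2 (Matrix.of fun i j : Fin 2 => if i.val + j.val + 1 = 2 then (1 : L) else 0) w) ⧸
      Subgroup.centralizer ({γ} : Set ↥(archLocal L 2 (Matrix.of fun i j : Fin 2 => if i.val + j.val + 1 = 2 then (1 : L) else 0) w)))]
    (ρ : Measure ↥(Subgroup.centralizer ({γ} : Set ↥(archLocal L 2 (Matrix.of fun i j : Fin 2 => if i.val + j.val + 1 = 2 then (1 : L) else 0) w))))
    [ρ.IsHaarMeasure] [ρ.IsInvInvariant] :
    ∃ C : ℝ, ∀ r : ℝ, 1 ≤ r →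
      quotientMeasure (Subgroup.centralizer ({γ} : Set ↥(archLocal L 2 (Matrix.of fun i j : Fin 2 => if i.val + j.val + 1 = 2 then (1 : L) else 0) w))) ρ
          (isClosed_coe_centralizer_singleton γ) ν
        {x | descConj γ (Subgroup.centralizer ({γ} : Set ↥(archLocal L 2 (Matrix.of fun i j : Fin 2 => if i.val + j.val + 1 = 2 then (1 : L) else 0) w)))
            (fun _ h => Subgroup.mem_centralizer_singleton_iff.1 h)
            (fun y : ↥(archLocal L 2 (Matrix.of fun i j : Fin 2 => if i.val + j.val + 1 = 2 then (1 : L) else 0) w) =>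
              ∑ i : Fin 2, ∑ j : Fin 2, ‖((y : GL (Fin 2) ℂ) : Matrix (Fin 2) (Fin 2) ℂ) i j‖ ^ 2 + 1) x ≤ r} ≤
        ENNReal.ofReal (C * r ^ (1 / (2 : ℝ))) := by
  haveI : CompactSpace ↥(Subgroup.centralizer ({γ} : Set ↥(archLocal L 2 (Matrix.of fun i j : Fin 2 => if i.val + j.val + 1 = 2 then (1 : L) else 0) w))) :=
    isCompact_iff_compactSpace.mp (isCompact_centralizer_archLocal_of_conj_torusMatrix w γ g₀ hne hγ)
  haveI : IsClosed ((Subgroup.centralizer ({γ} : Set ↥(archLocal L 2 (Matrix.of fun i j : Fin 2 => if i.val + j.val + 1 = 2 then (1 : L) else 0) w)) :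
      Set ↥(archLocal L 2 (Matrix.of fun i j : Fin 2 => if i.val + j.val + 1 = 2 then (1 : L) else 0) w))) :=
    isClosed_coe_centralizer_singleton γ
  obtain ⟨C, hC⟩ := haar_setOf_hs_conj_le_of_elliptic_linear L w ν γ g₀ hne hγ
  -- constants of the compact descent
  have hρ0 : ρ Set.univ ≠ 0 := (isOpen_univ.measure_pos ρ univ_nonempty).ne'
  have hρtop : ρ Set.univ ≠ ⊤ := (isCompact_univ.measure_lt_top (μ := ρ)).ne
  set c : ℝ := (ρ Set.univ).toReal⁻¹ with hc
  have hcpos : 0 < c := inv_pos.mpr (ENNReal.toReal_pos hρ0 hρtop)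
  have hcinv : (ρ Set.univ)⁻¹ = ENNReal.ofReal c := by
    rw [hc, ENNReal.ofReal_inv_of_pos (ENNReal.toReal_pos hρ0 hρtop), ENNReal.ofReal_toReal hρtop]
  set C' : ℝ := max C 0 with hC'
  refine ⟨c * C', fun r hr => ?_⟩
  have hr0 : 0 < r := lt_of_lt_of_le one_pos hr
  -- measurability of the descended radius
  have hcont : Continuous fun y : ↥(archLocal L 2 (Matrix.of fun i j : Fin 2 => if i.val + j.val + 1 = 2 then (1 : L) else 0) w) =>
      ∑ i : Fin 2, ∑ j : Fin 2, ‖((y : GL (Fin 2) ℂ) : Matrix (Fin 2) (Fin 2) ℂ) i j‖ ^ 2 + 1 := by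
    have hv : Continuous fun y : ↥(archLocal L 2 (Matrix.of fun i j : Fin 2 => if i.val + j.val + 1 = 2 then (1 : L) else 0) w) =>
        ((y : GL (Fin 2) ℂ) : Matrix (Fin 2) (Fin 2) ℂ) := Units.continuous_val.comp continuous_subtype_val
    exact (continuous_finsetSum _ fun i _ => continuous_finsetSum _ fun j _ => ((hv.matrix_elem i j).norm).pow 2).add continuous_const
  have hS : MeasurableSet {x | descConj γ (Subgroup.centralizer ({γ} : Set ↥(archLocal L 2 (Matrix.of fun i j : Fin 2 => if i.val + j.val + 1 = 2 then (1 : L) else 0) w)))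
      (fun _ h => Subgroup.mem_centralizer_singleton_iff.1 h)
      (fun y : ↥(archLocal L 2 (Matrix.of fun i j : Fin 2 => if i.val + j.val + 1 = 2 then (1 : L) else 0) w) =>
        ∑ i : Fin 2, ∑ j : Fin 2, ‖((y : GL (Fin 2) ℂ) : Matrix (Fin 2) (Fin 2) ℂ) i j‖ ^ 2 + 1) x ≤ r} :=
    measurableSet_le (continuous_descConj γ _ _ hcont).measurable measurable_const
  rw [quotientMeasure_eq_inv_smul_map_mk _ ρ ν, Measure.smul_apply, Measure.map_apply QuotientGroup.continuous_mk.measurable hS, smul_eq_mul, hcinv]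
  have hpre : (QuotientGroup.mk : _ → ↥(archLocal L 2 (Matrix.of fun i j : Fin 2 => if i.val + j.val + 1 = 2 then (1 : L) else 0) w) ⧸
      Subgroup.centralizer ({γ} : Set _)) ⁻¹'
      {x | descConj γ (Subgroup.centralizer ({γ} : Set ↥(archLocal L 2 (Matrix.of fun i j : Fin 2 => if i.val + j.val + 1 = 2 then (1 : L) else 0) w)))
        (fun _ h => Subgroup.mem_centralizer_singleton_iff.1 h)
        (fun y : ↥(archLocal L 2 (Matrix.of fun i j : Fin 2 => if i.val + j.val + 1 = 2 then (1 : L) else 0) w) =>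
          ∑ i : Fin 2, ∑ j : Fin 2, ‖((y : GL (Fin 2) ℂ) : Matrix (Fin 2) (Fin 2) ℂ) i j‖ ^ 2 + 1) x ≤ r} =
      {y | ∑ i : Fin 2, ∑ j : Fin 2, ‖(((y * γ * y⁻¹ : ↥(archLocal L 2 (Matrix.of fun i j : Fin 2 => if i.val + j.val + 1 = 2 then (1 : L) else 0) w)) : GL (Fin 2) ℂ) : Matrix (Fin 2) (Fin 2) ℂ) i j‖ ^ 2 + 1 ≤ r} := rfl
  rw [hpre]
  have hX0 : 0 ≤ r ^ (1 / (2 : ℝ)) := Real.rpow_nonneg hr0.le _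
  calc ENNReal.ofReal c * ν {y | ∑ i : Fin 2, ∑ j : Fin 2, ‖(((y * γ * y⁻¹ : ↥(archLocal L 2 (Matrix.of fun i j : Fin 2 => if i.val + j.val + 1 = 2 then (1 : L) else 0) w)) : GL (Fin 2) ℂ) : Matrix (Fin 2) (Fin 2) ℂ) i j‖ ^ 2 + 1 ≤ r}
      ≤ ENNReal.ofReal c * ENNReal.ofReal (C' * r ^ (1 / (2 : ℝ))) := by
        refine mul_le_mul' le_rfl ((hC r hr).trans (ENNReal.ofReal_le_ofReal ?_))
        exact mul_le_mul_of_nonneg_right (le_max_left _ _) hX0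
    _ = ENNReal.ofReal (c * C' * r ^ (1 / (2 : ℝ))) := by
        rw [← ENNReal.ofReal_mul hcpos.le]
        congr 1
        ring

end EllipticPlace

end Literature.NumberTheory.Rogawski1990

end
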